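import Summits.QuantumFields.BalabanUV.Beta.KernelWardRelative
import Summits.QuantumFields.BalabanUV.Beta.SpineRootedBmN
import Summits.QuantumFields.BalabanUV.Beta.BubbleParity

/-!
# `BalabanUV.Beta.KernelWardRelativeEnd` — the WARD-TRANSVERSALITY END (`hW`) over a RELATIVE inverse, file 2 of 2: the block-mean axially
# DRESSED one-step family and the wiring for the centred native spine `JsBalBmNAtOf` over `axEc` (β sub-cell, row BETA-an1, gen 25;
# item SKELETON-D1-hW (an1), root composition)

HONEST FRAMING (cell contract, verbatim): «discharging `BetaPertH` makes Bałaban's UV stability UNCONDITIONAL — a real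
constructive-QFT result; it is NOT the continuum limit and NOT the Clay problem.»  THIS MODULE mints no `Prop` fact and no `def`, cites nothing
as a hypothesis, instantiates NO binder of the wall and DISCHARGES NOTHING of it: it is the `hW` twin of an2's
`AxialDressingRooted.axisReflectionCovariant_flipK_TbalOf_dressBmAt_rel` and `SpineRooted.axisReflectionCovariant_flipK_TbalOf_JsBalBmNAtOf_ctrC`.
Every jet law, inverse rule and Ward law below is a HYPOTHESIS (socket) of the END, never a fact.

## What is here

* §3 `wardTransversal_flipK_TbalOf_dressBmAt_rel`: for UNDRESSED step jets `Js⁰ : ℕ → JetData 3 Lc` and an in-block root `r`, with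
  `G_j := coDressKBmAt (toSite r) Lc (KInvStep Lc j)` (decay and block covariance are theorems: `decays_coDressKBmAt_KInvStep`,
  `shiftK_coDressKBmAt_KInvStep`), the sockets of file 1 §2 per step `j` ⟹ `∀ j, WardTransversal (flipK (TbalOf Lc (fun j ↦ dressBmAt hr (Js⁰ j)) j))`
  (`TbalOf_dressBmAt` + `KernelWardRelative.wardTransversal_flipK_hessKer_conj_rel`);
* §4 `wardTransversal_flipK_TbalOf_JsBalBmNAtOf_ctrC`: the centred root `ctrOff 4 Lc` (odd `Lc`), `E := axEc ρ_c Lc` (rules 1–2 of `RelInv` inside by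
  `axEc_rules_coDressKBmAt_KInvStep`, spread by `spr_axEc`), (St)/(Wt) by `JsBal0NAtOf_S_translate` / `JsBal0NAtOf_W_translate`; BINDERS h3/h4,
  the ℋ-column Ward law `hH`, the generator / contact / remainder families and the pure-gauge jet laws `hSd`, `hWd`, `hN0` — conclusion
  `∀ j, WardTransversal (flipK (TbalOf Lc (JsBalBmNAtOf …) j))`, the LITERAL `hW` hypothesis of `OneStepKernelFamily.d1Drift_of_D1Tel_D1Rep` for the
  wall family.

* §5 THE PARITY FORM OF THE REMAINDER SOCKET.  `tadpole_eq_zero_of_parity` (the `tadpole` twin of an2's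
  `BubbleParity.bubble_eq_zero_of_parity`): a sgn-symmetric spread propagator (`trK K = sgnK K`) has vanishing tadpole against a localised
  sgn-ANTISYMMETRIC vertex (`trK N = −sgnK N`); since the co-dressed step resolvents ARE sgn-symmetric (`BubbleParity.trK_coDressKBmAt_KInvStep`,
  a theorem), `wardTransversal_flipK_TbalOf_JsBalBmNAtOf_ctrC_parity` replaces the scalar socket `hN0 : tadpole G_j (N …) = 0` of §4 by the
  STRUCTURAL socket `hNt : trK (N …) = −sgnK (N …)` (the stripped rotated first-order vertex is sgn-antisymmetric).  DESIGN NOTE (typing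
  discipline): with `hN0` scalar, the pair (`hWd`, `hN0`) admits the degenerate instantiation `X₂ := 0`, `N := divW W − conjW …`, under which
  `hN0` is the tadpole form of the Ward identity itself; the parity form excludes that reading — the remainder must be NAMED and its nullity
  must come from parity alone.

All declarations `[folklore]`; axioms standard.  Provenance: b2b-balaban β sub-cell, unit beta-an1 gen 25, 2026-08-20 (v1); over
`KernelWardRelative` / `AxialDressingRootedBmHessian` / `AxialCoordinateProjectorCoarse(Rules)` / `SpineRootedStepN` / `SpineRootedBmN` BY NAME;
no existing file touched.
-/

open Finset
open scoped BigOperators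
open Literature.MathematicalPhysics.QuantumFieldTheory
open Literature.MathematicalPhysics.QuantumFieldTheory.Balaban1983to89
open Literature.MathematicalPhysics.QuantumFieldTheory.Balaban1983to89.Beta
open B6BondElimination (unitVec unitVec_apply)
open ExpKernelCalculus (MKer Decays BiLoc comp tr tadpole VertexFamily₂ shiftK)
open PolarizationSign (WardTransversal)
open KernelWard (divV divW)
open AffineAveraging (box toSite)
open AveragingContoursRooted (ctrOff ctrOff_mem_box)
open OneStepResolventKernel (Fib LocStencil JetData)
open OneStepKernelFamily (KInvStep colH vertexOfK TbalOf flipK)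
open Summit.QuantumFields.BalabanUV.Beta.TameKernelCalculus
open Summit.QuantumFields.BalabanUV.Beta.ChartConjugation (conjV conjW)
open Summit.QuantumFields.BalabanUV.Beta.ChartConjugationRelative (RelInv)
open Summit.QuantumFields.BalabanUV.Beta.AxialDressingRooted (dressBmAt coDressKBmAt TbalOf_dressBmAt decays_coDressKBmAt_KInvStep
  shiftK_coDressKBmAt_KInvStep one_le_of_neZero axEc spr_axEc axEc_rules_coDressKBmAt_KInvStep)
open Summit.QuantumFields.BalabanUV.Beta.SpineRooted (JsBal0NAtOf JsBalBmNAtOf JsBal0NAtOf_S_translate JsBal0NAtOf_W_translate)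
open Summit.QuantumFields.BalabanUV.Beta.KernelWardRelative (gaugeWt wardTransversal_flipK_hessKer_conj_rel)
open Summit.QuantumFields.BalabanUV.Beta.BorderedHessian (sgnK comp_sgnK)
open Summit.QuantumFields.BalabanUV.Beta.BubbleParity (tr_neg tr_sgnK spr_of_decays trK_coDressKBmAt_KInvStep)

namespace Summit.QuantumFields.BalabanUV.Beta.KernelWardRelativeEnd

noncomputable section

/-! ## §3 The END for the block-mean axially DRESSED one-step family (dimension four) -/

section Dressed

/-- **THE `hW` BINDER FOR THE BLOCK-MEAN DRESSED WALL FAMILY, OVER THE RELATIVE SOCKETS.**  Let `Js⁰ : ℕ → JetData 3 Lc` be UNDRESSED step jets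
and `r` an in-block root; the dressed family is `fun j ↦ dressBmAt hr (Js⁰ j)` (the shape of `SpineRooted.JsBalBmNAtOf`).  Per step `j` put
`G_j := coDressKBmAt (toSite r) Lc (KInvStep Lc j)` (its decay and block covariance are theorems).  BINDERS: spread `𝕄 j` and `E` with
`RelInv G_j (𝕄 j) E`; the translation laws (St), (Wt) of the undressed jets; the ℋ-column Ward law of `G_j` (constant `c_H j`); generator families `X j y`
and contacts `X₂ j`, both localised and commuting with `E`, tadpole-null remainders `N j`; the block stencil Ward law with contact and the second-order
pure-gauge law of the UNDRESSED jets against `𝕄 j`.  CONCLUSION: `∀ j, WardTransversal (flipK (TbalOf Lc (fun j ↦ dressBmAt hr (Js⁰ j)) j))` — the `hW`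
hypothesis of `OneStepKernelFamily.d1Drift_of_D1Tel_D1Rep` for the dressed family.  Proof: `TbalOf_dressBmAt` + §2.  Discharges nothing by itself.
[folklore] -/
theorem wardTransversal_flipK_TbalOf_dressBmAt_rel {Lc : ℕ} [NeZero Lc] {r : Fin 4 → ℕ} (hr : r ∈ box 4 Lc) (Js : ℕ → JetData 3 Lc)
    (M : ℕ → MKer 4 (Fib 3)) (E : MKer 4 (Fib 3)) (hM : ∀ j, Spr (M j)) (hE : Spr E)
    (hR : ∀ j, RelInv (coDressKBmAt (toSite r) Lc (KInvStep (d := 3) Lc j)) (M j) E)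
    (hSt : ∀ (j : ℕ) (κ' : Fin 4) (u t : Fin 4 → ℤ), (Js j).S κ' (u + (Lc : ℤ) • t) = shiftK (-((Lc : ℤ) • t)) ((Js j).S κ' u))
    (hWt : ∀ (j : ℕ) (μ : Fin 4) (y : Fin 4 → ℤ) (ν : Fin 4) (y' t : Fin 4 → ℤ),
      (Js j).W μ (y + t) ν (y' + t) = shiftK (-((Lc : ℤ) • t)) ((Js j).W μ y ν y'))
    (cH : ℕ → ℝ) (hH : ∀ (j : ℕ) (y : Fin 4 → ℤ) (κ' : Fin 4) (u : Fin 4 → ℤ),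
      ∑ μ, (colH (coDressKBmAt (toSite r) Lc (KInvStep (d := 3) Lc j)) Lc μ (y - unitVec μ) κ' u
        - colH (coDressKBmAt (toSite r) Lc (KInvStep (d := 3) Lc j)) Lc μ y κ' u) = cH j * gaugeWt Lc y κ' u)
    (X : ℕ → (Fin 4 → ℤ) → MKer 4 (Fib 3)) (hX : ∀ j y, Loc (X j y)) (hEX : ∀ j y, comp E (X j y) = comp (X j y) E)
    (X₂ Nr : ℕ → (Fin 4 → ℤ) → Fin 4 → (Fin 4 → ℤ) → MKer 4 (Fib 3)) (hX₂ : ∀ j y ν y', Loc (X₂ j y ν y'))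
    (hNr : ∀ j y ν y', Loc (Nr j y ν y')) (hEX₂ : ∀ j y ν y', comp E (X₂ j y ν y') = comp (X₂ j y ν y') E)
    (hSd : ∀ (j : ℕ) (y : Fin 4 → ℤ), cH j • ∑ v ∈ box 4 Lc, divV (Js j).S ((Lc : ℤ) • y + toSite v) = conjV (M j) (X j y))
    (hWd : ∀ (j : ℕ) (y : Fin 4 → ℤ) (ν : Fin 4) (y' : Fin 4 → ℤ),
      divW (Js j).W y ν y' = conjW (M j) 0 (vertexOfK (coDressKBmAt (toSite r) Lc (KInvStep (d := 3) Lc j)) Lc (Js j).S ν y') (X j y) 0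
        (X₂ j y ν y') + Nr j y ν y')
    (hN0 : ∀ j y ν y', tadpole (coDressKBmAt (toSite r) Lc (KInvStep (d := 3) Lc j)) (Nr j y ν y') = 0) :
    ∀ j : ℕ, WardTransversal (flipK (TbalOf Lc (fun j => dressBmAt hr (Js j)) j)) := by
  intro j
  rw [TbalOf_dressBmAt hr Js j]
  exact wardTransversal_flipK_hessKer_conj_rel (decays_coDressKBmAt_KInvStep hr j) (shiftK_coDressKBmAt_KInvStep (toSite r) j)
    (one_le_of_neZero Lc) (hM j) hE (hR j) (Js j) (hSt j) (hWt j) (cH j) (hH j) (X j) (hX j) (hEX j) (X₂ j) (Nr j) (hX₂ j) (hNr j)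
    (hEX₂ j) (hSd j) (hWd j) (hN0 j)

end Dressed

/-! ## §4 The wiring for the centred native spine `JsBalBmNAtOf` over the coarse coordinate projector `axEc` -/

section Wiring

/-- **`hW` FOR THE CENTRED Π_bm-CO-DRESSED NATIVE SPINE OVER `axEc`** (twin of `SpineRooted.axisReflectionCovariant_flipK_TbalOf_JsBalBmNAtOf_ctrC`):
rules 1–2 of `RelInv` inside by `axEc_rules_coDressKBmAt_KInvStep`, `E := axEc ρ_c Lc` spread by `spr_axEc`, (St)/(Wt) by `JsBal0NAtOf_S_translate` /
`JsBal0NAtOf_W_translate`; BINDERS h3/h4 (`𝕄 j`), the ℋ-column Ward law `hH`, the generator / contact / remainder families and the pure-gauge jet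
laws `hSd`, `hWd`, `hN0`.  CONCLUSION: the literal `hW` hypothesis of `OneStepKernelFamily.d1Drift_of_D1Tel_D1Rep` for the wall family.
Discharges nothing of the wall by itself. [folklore] -/
theorem wardTransversal_flipK_TbalOf_JsBalBmNAtOf_ctrC {Lc : ℕ} [NeZero Lc] (hLc : Odd Lc) (cE cVH cΛ : ℝ)
    (W : ℕ → Fin 4 → (Fin 4 → ℤ) → Fin 4 → (Fin 4 → ℤ) → MKer 4 (Fib 3)) (Cw δw : ℕ → ℝ) (hδw : ∀ j, 0 < δw j)
    (hW : ∀ j, VertexFamily₂ (W j) Lc (Cw j) (δw j))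
    (hWt : ∀ (j : ℕ) (μ : Fin 4) (y : Fin 4 → ℤ) (ν : Fin 4) (y' t : Fin 4 → ℤ),
      W j μ (y + t) ν (y' + t) = shiftK (-((Lc : ℤ) • t)) (W j μ y ν y'))
    (M : ℕ → MKer 4 (Fib 3)) (hM : ∀ j, Spr (M j))
    (h3 : ∀ j, comp (comp (coDressKBmAt (toSite (ctrOff 4 Lc)) Lc (KInvStep (d := 3) Lc j)) (M j)) (axEc (toSite (ctrOff 4 Lc)) Lc) =
      axEc (toSite (ctrOff 4 Lc)) Lc)
    (h4 : ∀ j, comp (comp (axEc (toSite (ctrOff 4 Lc)) Lc) (M j)) (coDressKBmAt (toSite (ctrOff 4 Lc)) Lc (KInvStep (d := 3) Lc j)) =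
      axEc (toSite (ctrOff 4 Lc)) Lc)
    (cH : ℕ → ℝ) (hH : ∀ (j : ℕ) (y : Fin 4 → ℤ) (κ' : Fin 4) (u : Fin 4 → ℤ),
      ∑ μ, (colH (coDressKBmAt (toSite (ctrOff 4 Lc)) Lc (KInvStep (d := 3) Lc j)) Lc μ (y - unitVec μ) κ' u
        - colH (coDressKBmAt (toSite (ctrOff 4 Lc)) Lc (KInvStep (d := 3) Lc j)) Lc μ y κ' u) = cH j * gaugeWt Lc y κ' u)
    (X : ℕ → (Fin 4 → ℤ) → MKer 4 (Fib 3)) (hX : ∀ j y, Loc (X j y))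
    (hEX : ∀ j y, comp (axEc (toSite (ctrOff 4 Lc)) Lc) (X j y) = comp (X j y) (axEc (toSite (ctrOff 4 Lc)) Lc))
    (X₂ Nr : ℕ → (Fin 4 → ℤ) → Fin 4 → (Fin 4 → ℤ) → MKer 4 (Fib 3)) (hX₂ : ∀ j y ν y', Loc (X₂ j y ν y'))
    (hNr : ∀ j y ν y', Loc (Nr j y ν y'))
    (hEX₂ : ∀ j y ν y', comp (axEc (toSite (ctrOff 4 Lc)) Lc) (X₂ j y ν y') = comp (X₂ j y ν y') (axEc (toSite (ctrOff 4 Lc)) Lc))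
    (hSd : ∀ (j : ℕ) (y : Fin 4 → ℤ), cH j • ∑ v ∈ box 4 Lc,
      divV (JsBal0NAtOf (d := 3) hLc.pos (ctrOff_mem_box hLc.pos) cE cVH cΛ W Cw δw hδw hW j).S ((Lc : ℤ) • y + toSite v) = conjV (M j) (X j y))
    (hWd : ∀ (j : ℕ) (y : Fin 4 → ℤ) (ν : Fin 4) (y' : Fin 4 → ℤ),
      divW (JsBal0NAtOf (d := 3) hLc.pos (ctrOff_mem_box hLc.pos) cE cVH cΛ W Cw δw hδw hW j).W y ν y' =
        conjW (M j) 0 (vertexOfK (coDressKBmAt (toSite (ctrOff 4 Lc)) Lc (KInvStep (d := 3) Lc j)) Lc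
          (JsBal0NAtOf (d := 3) hLc.pos (ctrOff_mem_box hLc.pos) cE cVH cΛ W Cw δw hδw hW j).S ν y') (X j y) 0 (X₂ j y ν y') + Nr j y ν y')
    (hN0 : ∀ j y ν y', tadpole (coDressKBmAt (toSite (ctrOff 4 Lc)) Lc (KInvStep (d := 3) Lc j)) (Nr j y ν y') = 0) :
    ∀ j : ℕ, WardTransversal
      (flipK (TbalOf Lc (JsBalBmNAtOf (d := 3) hLc.pos (ctrOff_mem_box hLc.pos) cE cVH cΛ W Cw δw hδw hW) j)) := by
  have hR : ∀ j, RelInv (coDressKBmAt (toSite (ctrOff 4 Lc)) Lc (KInvStep (d := 3) Lc j)) (M j) (axEc (toSite (ctrOff 4 Lc)) Lc) :=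
    fun j => ⟨(axEc_rules_coDressKBmAt_KInvStep (ctrOff_mem_box (one_le_of_neZero Lc)) j).1,
      (axEc_rules_coDressKBmAt_KInvStep (ctrOff_mem_box (one_le_of_neZero Lc)) j).2, h3 j, h4 j⟩
  exact wardTransversal_flipK_TbalOf_dressBmAt_rel (ctrOff_mem_box hLc.pos)
    (JsBal0NAtOf (d := 3) hLc.pos (ctrOff_mem_box hLc.pos) cE cVH cΛ W Cw δw hδw hW) M (axEc (toSite (ctrOff 4 Lc)) Lc) hM (spr_axEc _ _)
    hR (JsBal0NAtOf_S_translate hLc.pos (ctrOff_mem_box hLc.pos) cE cVH cΛ W Cw δw hδw hW)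
    (JsBal0NAtOf_W_translate hLc.pos (ctrOff_mem_box hLc.pos) cE cVH cΛ W Cw δw hδw hW hWt) cH hH X hX hEX X₂ Nr hX₂ hNr hEX₂ hSd hWd hN0

end Wiring


/-! ## §5 The parity form of the remainder socket -/

/-- [folklore] **TADPOLE PARITY LEMMA** (the `tadpole` twin of `BubbleParity.bubble_eq_zero_of_parity`).  A sgn-symmetric spread
propagator `K` (`trK K = sgnK K`) has vanishing tadpole `tadpole K N = tr (K ∘ N)` against a localised sgn-ANTISYMMETRIC vertex `N`
(`trK N = −sgnK N`): transpose (`tr ∘ trK = tr`, `trK (K ∘ N) = Nᵀ ∘ Kᵀ = −S(N ∘ K)S`), drop the sign conjugation under the trace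
(`tr_sgnK`) and close with tame cyclicity (`tr_comp_comm_loc`). -/
theorem tadpole_eq_zero_of_parity {d : ℕ} {K N : MKer (d + 1) (Fib d)} (hK : Spr K) (hKt : trK K = sgnK K) (hN : Loc N)
    (hNt : trK N = -sgnK N) : tadpole K N = 0 := by
  have h1 : trK (comp K N) = -sgnK (comp N K) := by
    rw [trK_comp, hKt, hNt, comp_neg_left, comp_sgnK]
  have h2 : tr (comp N K) = tr (comp K N) := tr_comp_comm_loc hN hK.tame
  have h3 : tr (comp K N) = -tr (comp K N) := by
    conv_lhs => rw [← tr_trK (comp K N), h1]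
    rw [tr_neg, tr_sgnK, h2]
  unfold ExpKernelCalculus.tadpole
  linarith

/-- [folklore] **THE `hW` END FOR THE WALL FAMILY, PARITY FORM OF THE REMAINDER.**  As `wardTransversal_flipK_TbalOf_JsBalBmNAtOf_ctrC`
(§4), with the scalar remainder socket `hN0 : tadpole G_j (N j y ν y′) = 0` replaced by the STRUCTURAL one
`hNt : trK (N j y ν y′) = −sgnK (N j y ν y′)` — discharged inside by `tadpole_eq_zero_of_parity`, the co-dressed step resolvents being
sgn-symmetric (`BubbleParity.trK_coDressKBmAt_KInvStep`) and spread (`decays_coDressKBmAt_KInvStep`).  Conclusion: the LITERAL `hW`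
hypothesis of `OneStepKernelFamily.d1Drift_of_D1Tel_D1Rep` for the wall family `JsBalBmNAtOf` at the centred root. -/
theorem wardTransversal_flipK_TbalOf_JsBalBmNAtOf_ctrC_parity {Lc : ℕ} [NeZero Lc] (hLc : Odd Lc) (cE cVH cΛ : ℝ)
    (W : ℕ → Fin 4 → (Fin 4 → ℤ) → Fin 4 → (Fin 4 → ℤ) → MKer 4 (Fib 3)) (Cw δw : ℕ → ℝ) (hδw : ∀ j, 0 < δw j)
    (hW : ∀ j, VertexFamily₂ (W j) Lc (Cw j) (δw j))
    (hWt : ∀ (j : ℕ) (μ : Fin 4) (y : Fin 4 → ℤ) (ν : Fin 4) (y' t : Fin 4 → ℤ),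
      W j μ (y + t) ν (y' + t) = shiftK (-((Lc : ℤ) • t)) (W j μ y ν y'))
    (M : ℕ → MKer 4 (Fib 3)) (hM : ∀ j, Spr (M j))
    (h3 : ∀ j, comp (comp (coDressKBmAt (toSite (ctrOff 4 Lc)) Lc (KInvStep (d := 3) Lc j)) (M j)) (axEc (toSite (ctrOff 4 Lc)) Lc) =
      axEc (toSite (ctrOff 4 Lc)) Lc)
    (h4 : ∀ j, comp (comp (axEc (toSite (ctrOff 4 Lc)) Lc) (M j)) (coDressKBmAt (toSite (ctrOff 4 Lc)) Lc (KInvStep (d := 3) Lc j)) =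
      axEc (toSite (ctrOff 4 Lc)) Lc)
    (cH : ℕ → ℝ) (hH : ∀ (j : ℕ) (y : Fin 4 → ℤ) (κ' : Fin 4) (u : Fin 4 → ℤ),
      ∑ μ, (colH (coDressKBmAt (toSite (ctrOff 4 Lc)) Lc (KInvStep (d := 3) Lc j)) Lc μ (y - unitVec μ) κ' u
        - colH (coDressKBmAt (toSite (ctrOff 4 Lc)) Lc (KInvStep (d := 3) Lc j)) Lc μ y κ' u) = cH j * gaugeWt Lc y κ' u)
    (X : ℕ → (Fin 4 → ℤ) → MKer 4 (Fib 3)) (hX : ∀ j y, Loc (X j y))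
    (hEX : ∀ j y, comp (axEc (toSite (ctrOff 4 Lc)) Lc) (X j y) = comp (X j y) (axEc (toSite (ctrOff 4 Lc)) Lc))
    (X₂ Nr : ℕ → (Fin 4 → ℤ) → Fin 4 → (Fin 4 → ℤ) → MKer 4 (Fib 3)) (hX₂ : ∀ j y ν y', Loc (X₂ j y ν y'))
    (hNr : ∀ j y ν y', Loc (Nr j y ν y'))
    (hEX₂ : ∀ j y ν y', comp (axEc (toSite (ctrOff 4 Lc)) Lc) (X₂ j y ν y') = comp (X₂ j y ν y') (axEc (toSite (ctrOff 4 Lc)) Lc))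
    (hSd : ∀ (j : ℕ) (y : Fin 4 → ℤ), cH j • ∑ v ∈ box 4 Lc,
      divV (JsBal0NAtOf (d := 3) hLc.pos (ctrOff_mem_box hLc.pos) cE cVH cΛ W Cw δw hδw hW j).S ((Lc : ℤ) • y + toSite v) = conjV (M j) (X j y))
    (hWd : ∀ (j : ℕ) (y : Fin 4 → ℤ) (ν : Fin 4) (y' : Fin 4 → ℤ),
      divW (JsBal0NAtOf (d := 3) hLc.pos (ctrOff_mem_box hLc.pos) cE cVH cΛ W Cw δw hδw hW j).W y ν y' =
        conjW (M j) 0 (vertexOfK (coDressKBmAt (toSite (ctrOff 4 Lc)) Lc (KInvStep (d := 3) Lc j)) Lc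
          (JsBal0NAtOf (d := 3) hLc.pos (ctrOff_mem_box hLc.pos) cE cVH cΛ W Cw δw hδw hW j).S ν y') (X j y) 0 (X₂ j y ν y') + Nr j y ν y')
    (hNt : ∀ j y ν y', trK (Nr j y ν y') = -sgnK (Nr j y ν y')) :
    ∀ j : ℕ, WardTransversal
      (flipK (TbalOf Lc (JsBalBmNAtOf (d := 3) hLc.pos (ctrOff_mem_box hLc.pos) cE cVH cΛ W Cw δw hδw hW) j)) :=
  wardTransversal_flipK_TbalOf_JsBalBmNAtOf_ctrC hLc cE cVH cΛ W Cw δw hδw hW hWt M hM h3 h4 cH hH X hX hEX X₂ Nr hX₂ hNr hEX₂ hSd hWd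
    fun j y ν y' => tadpole_eq_zero_of_parity (spr_of_decays (decays_coDressKBmAt_KInvStep (ctrOff_mem_box hLc.pos) j))
      (trK_coDressKBmAt_KInvStep (ctrOff_mem_box hLc.pos) j) (hNr j y ν y') (hNt j y ν y')

end

end Summit.QuantumFields.BalabanUV.Beta.KernelWardRelativeEnd
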